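import Literature.NumberTheory.Sieve.MatomakiRadziwillProp1
import HarnessLib

/-!
# Matomäki–Radziwiłł 2016, Theorem 3: reduction to the minimal analytic input `ζ(1 + it) ≪ (log t)^{2/3}`

Topic `NumberTheory/Sieve`.  Everything in this file is PROVED; there are no definitions and no named
facts.  It belongs to the discharge programme of
`Literature.NumberTheory.Sieve.MatomakiRadziwill2016_theorem3` (K. Matomäki, M. Radziwiłł,
*Multiplicative functions in short intervals*, Ann. of Math. 183 (2016), Theorem 3).

State of the tree (2026-08-15).  §9 of the paper (Theorem 3 from Proposition 1 and Lemmas 4, 14) and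
§8 (Proposition 1 from Lemmas 3, 5–9, 11–13) are proved
(`MatomakiRadziwill2016_theorem3_of_lemma3_lemma4_lemma11`, `MatomakiRadziwillProp1.lean`), and Lemma 3 is
proved from Granville–Soundararajan's Theorem 1 (discharged: `GranvilleSoundararajan2003_theorem1_holds`) and
the named fact `zeta_bound_ford` (Ford 2002, Theorem 1: `|ζ(σ + it)| ≤ 76.2 t^{4.45(1−σ)^{3/2}} (log t)^{2/3}`,
`1/2 ≤ σ ≤ 1`, `t ≥ 3`), `MatomakiRadziwill2016_lemma3_of_GS_ford`.  That fact is far stronger than what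
the proof consumes: Ford's bound enters only at `σ = 1` (`PretentiousFord.norm_zeta_one_line_le`), in the
proof of the paper's Lemma 2 ("`𝔻(1, p^{2iα}; x)² ≥ (1/3 − ε) log log x + O(1)` … by the zero-free
region for the Riemann zeta-function"), where any bound

  `(VK₁)`  `|ζ(1 + it)| ≤ A₀ (log t)^{2/3}`  for `t ≥ T₀`,  with SOME constants `A₀`, `T₀`,

gives the same conclusion (the constant `A₀` and the threshold `T₀` only move the `O_A(1)`).  `(VK₁)` is
the Vinogradov–Korobov estimate on the one-line in qualitative form (Ivić, *The Riemann zeta-function*,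
Thm 6.3; Titchmarsh, (6.19.2)); Ford's theorem is one explicit instance (`A₀ = 76.2`, `T₀ = 3`,
`oneLine_of_ford`).  This file re-runs the last two steps of the in-tree deduction with `(VK₁)` — stated
inline as a hypothesis, not vendored — in place of `zeta_bound_ford`:

* `PretentiousFord.exists_bound_zeta_box_le` — `ζ` is bounded on `1 ≤ σ ≤ 2`, `2 ≤ |t| ≤ T` (compactness;
  the tree's `exists_bound_zeta_box` is `T = 3`);
* `PretentiousFord.norm_zeta_one_line_le_of_oneLine` — `(VK₁)` for `|t| ≥ T₀` from `(VK₁)` for `t ≥ T₀`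
  (`ζ(s̄) = conj ζ(s)`);
* `PretentiousFord.pretentiousDistSq_one_twist_ge_of_oneLine` — **the analytic content of MR Lemma 2 from
  `(VK₁)`**: for `A > 0` there are `x₀, C` with `𝔻(1, n^{it}; x)² ≥ (1/3) log log x − C` for `x ≥ x₀`,
  `2 ≤ |t| ≤ x^A` (the proof of `PretentiousFord.pretentiousDistSq_one_twist_ge` verbatim, with `76.2 ↦ A₀`,
  `3 ↦ max 3 T₀`); `PretentiousFord.matomakiRadziwill_lemma2_of_oneLine` — MR **Lemma 2** (squared form,
  constant `1/12`) from `(VK₁)`;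
* `MatomakiRadziwill2016_lemma3_of_GS_dist` — **Lemma 3 from GS Theorem 1 and the distance bound of
  Lemma 2 taken as a hypothesis** (the assembly of `MatomakiRadziwill2016_lemma3_of_GS_ford` verbatim; all
  its ingredients — `MatomakiRadziwillL3.first_part_numeric`, `second_part_numeric`, `threshold`, … — are
  proved in `MatomakiRadziwillLemma3.lean`);
* `MatomakiRadziwill2016_lemma3_of_oneLine`, `MatomakiRadziwill2016_prop1_of_oneLine_lemma11`,
  `MatomakiRadziwill2016_theorem3_of_oneLine_lemma4_lemma11`, `MatomakiRadziwill2016_theorem1_of_oneLine_lemma4_lemma11`,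
  `matomaki_radziwill_of_oneLine_lemma4_lemma11` — Lemma 3, Proposition 1, Theorem 3, Theorem 1 and
  parity.S38 with `(VK₁)` as the only analytic input beyond the tree (plus the paper's Lemma 4 and Lemma 11,
  named facts with their own discharge programmes);
* `oneLine_of_ford`, `MatomakiRadziwill2016_theorem3_of_ford_lemma4_lemma11` — the instance `A₀ = 76.2`,
  `T₀ = 3` recovers the Ford route.

Why `(VK₁)` cannot be weakened further for the printed exponents: `𝔻(1, n^{it}; x)² = log log x −
log|ζ(1 + 1/log x + it)| + O(1)`, so a lower bound `c log log x` at heights `|t| = x^A` is equivalent to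
`|ζ(1 + 1/log x + it)| ≪ (log x)^{1−c}` there; the Weyl–van der Corput bound `ζ(1+it) ≪ log t/log log t`
only yields `𝔻² ≥ log log log x − O(1)`, which does not give the saving `(log X)^{-1/16}` of Lemma 3.

## References

* K. Matomäki, M. Radziwiłł, *Multiplicative functions in short intervals*, Ann. of Math. (2) 183 (2016),
  1015–1056 (arXiv:1501.04585): Lemma 2 and its proof (arXiv p. 8), Lemma 3, Proposition 1, Theorem 3, §9.
  [cite: MatomakiRadziwillAnnals2016, Lemma 2, Lemma 3, Theorem 3]
* K. Ford, *Vinogradov's integral and bounds for the Riemann zeta function*, Proc. London Math. Soc. (3) 85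
  (2002), 565–633, Theorem 1. [cite: Ford2002, Theorem 1]
* A. Ivić, *The Riemann Zeta-Function*, Wiley 1985, Theorem 6.3 (the bound `ζ(1+it) ≪ (log t)^{2/3}`).
-/

noncomputable section

namespace Literature.NumberTheory.LFunctions

namespace PretentiousFord

open Complex Real Set

/-! ### Compactness bound up to an arbitrary height -/

/-- `ζ` is bounded on `{σ + it : 1 ≤ σ ≤ 2, 2 ≤ |t| ≤ T}` for every real `T` (continuity of `ζ` away from
`s = 1` on a compact set; for `T < 2` the set is empty). [folklore] -/
theorem exists_bound_zeta_box_le (T : ℝ) :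
    ∃ B : ℝ, 1 ≤ B ∧ ∀ σ t : ℝ, 1 ≤ σ → σ ≤ 2 → 2 ≤ |t| → |t| ≤ T →
      ‖riemannZeta (σ + t * I)‖ ≤ B := by
  set K : Set ℂ := (fun p : ℝ × ℝ => (p.1 : ℂ) + p.2 * I) '' (Icc 1 2 ×ˢ (Icc (-T) (-2) ∪ Icc 2 T))
    with hK
  have hKc : IsCompact K := by
    refine IsCompact.image (isCompact_Icc.prod (isCompact_Icc.union isCompact_Icc)) ?_
    fun_prop
  have hK1 : ∀ s ∈ K, s ≠ 1 := by
    rintro s ⟨p, hp, rfl⟩ h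
    have him := congrArg Complex.im h
    simp at him
    rcases hp.2 with h2 | h2 <;> [linarith [h2.2]; linarith [h2.1]]
  have hcont : ContinuousOn riemannZeta K := fun s hs =>
    (differentiableAt_riemannZeta (hK1 s hs)).continuousAt.continuousWithinAt
  obtain ⟨B, hB⟩ := hKc.exists_bound_of_continuousOn hcont
  refine ⟨max B 1, le_max_right _ _, fun σ t hσ1 hσ2 ht2 ht3 => (hB _ ?_).trans (le_max_left _ _)⟩
  refine ⟨(σ, t), ⟨⟨hσ1, hσ2⟩, ?_⟩, rfl⟩
  rcases le_or_gt 0 t with h0 | h0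
  · right; rw [abs_of_nonneg h0] at ht2 ht3; exact ⟨ht2, ht3⟩
  · left; rw [abs_of_neg h0] at ht2 ht3; exact ⟨by linarith, by linarith⟩

/-! ### The one-line hypothesis `(VK₁)` -/

/-- From `(VK₁)` for `t ≥ T₀` to `|t| ≥ T₀`, by `ζ(s̄) = conj ζ(s)`. [folklore] -/
theorem norm_zeta_one_line_le_of_oneLine {A₀ T₀ : ℝ}
    (hZ : ∀ t : ℝ, T₀ ≤ t → ‖riemannZeta (1 + t * I)‖ ≤ A₀ * Real.log t ^ (2 / 3 : ℝ))
    {t : ℝ} (ht : T₀ ≤ |t|) :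
    ‖riemannZeta (1 + t * I)‖ ≤ A₀ * Real.log |t| ^ (2 / 3 : ℝ) := by
  rcases le_or_gt 0 t with ht0 | ht0
  · rw [abs_of_nonneg ht0] at ht ⊢; exact hZ t ht
  · rw [abs_of_neg ht0] at ht ⊢
    have e : (1 : ℂ) + (t : ℂ) * I = starRingEnd ℂ (1 + ((-t : ℝ) : ℂ) * I) := by
      apply Complex.ext <;> simp
    rw [e, riemannZeta_conj, Complex.norm_conj]
    exact hZ (-t) ht

/-- Ford's bound gives `(VK₁)` with `A₀ = 76.2`, `T₀ = 3` (`PretentiousFord.norm_zeta_one_line_le`).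
[cite: Ford2002, Theorem 1] -/
theorem oneLine_of_ford (hF : zeta_bound_ford) :
    ∀ t : ℝ, 3 ≤ t → ‖riemannZeta (1 + t * I)‖ ≤ 76.2 * Real.log t ^ (2 / 3 : ℝ) := by
  intro t ht
  have h := norm_zeta_one_line_le hF (t := t) (by rw [abs_of_nonneg (by linarith)]; exact ht)
  rwa [abs_of_nonneg (by linarith : (0 : ℝ) ≤ t)] at h

/-! ### The distance `𝔻(1, n^{it}; x)²` for `2 ≤ |t| ≤ x^A` from `(VK₁)` -/

/-- **The Vinogradov–Korobov-type lower bound for the distance from `n^{it}`, from `(VK₁)`**: if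
`|ζ(1 + it)| ≤ A₀ (log t)^{2/3}` for `t ≥ T₀`, then for every `A > 0` there are `x₀, C` such that for
`x ≥ x₀` and `2 ≤ |t| ≤ x^A`, `𝔻(1, n^{it}; x)² ≥ (1/3) log log x − C`.
Proof: as for `pretentiousDistSq_one_twist_ge` — `𝔻(1, n^{it}; x)² = log log x − log|ζ(σ_x − it)| + O(1)`
(`σ_x = 1 + 1/log x`), `|ζ(σ_x − it)| ≤ e^{CA} |ζ(1 − it)|` (Grönwall, `exists_norm_zeta_right_le`) and
`|ζ(1 − it)| ≤ A₁ (log|t|)^{2/3}` for `|t| ≥ T₁ = max 3 T₀` (`A₁ = max A₀ 1`), so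
`log|ζ(σ_x − it)| ≤ (2/3) log log x + O_A(1)`; heights `2 ≤ |t| ≤ T₁` by compactness.
[cite: MatomakiRadziwillAnnals2016, Lemma 2 (proof)] -/
theorem pretentiousDistSq_one_twist_ge_of_oneLine {A₀ T₀ : ℝ}
    (hZ : ∀ t : ℝ, T₀ ≤ t → ‖riemannZeta (1 + t * I)‖ ≤ A₀ * Real.log t ^ (2 / 3 : ℝ))
    {A : ℝ} (hA : 0 < A) :
    ∃ x₀ C : ℝ, 3 ≤ x₀ ∧ ∀ x : ℝ, x₀ ≤ x → ∀ t : ℝ, 2 ≤ |t| → |t| ≤ x ^ A →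
      Real.log (Real.log x) / 3 - C ≤
        Sieve.pretentiousDistSq 1 (fun n : ℕ => (n : ℂ) ^ ((t : ℂ) * I)) x := by
  obtain ⟨x₁, C₁, hx₁, hD⟩ := exists_pretentiousDistSq_one_zeta_approx
  obtain ⟨C₂, hC₂, hG⟩ := exists_norm_zeta_right_le
  -- thresholds and constants
  set T₁ : ℝ := max 3 T₀ with hT₁
  set A₁ : ℝ := max A₀ 1 with hA₁
  have hT₁3 : 3 ≤ T₁ := le_max_left _ _
  have hA₁1 : 1 ≤ A₁ := le_max_right _ _
  have hA₁0 : 0 < A₁ := by linarith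
  obtain ⟨B, hB1, hB⟩ := exists_bound_zeta_box_le T₁
  -- `(VK₁)` for `|t| ≥ T₁` with the constant `A₁`
  have hZ₁ : ∀ t : ℝ, T₁ ≤ |t| → ‖riemannZeta (1 + t * I)‖ ≤ A₁ * Real.log |t| ^ (2 / 3 : ℝ) := by
    intro t ht
    have h := norm_zeta_one_line_le_of_oneLine hZ (le_trans (le_max_right _ _) ht)
    have hl : 0 ≤ Real.log |t| ^ (2 / 3 : ℝ) :=
      Real.rpow_nonneg (Real.log_nonneg (by linarith : (1 : ℝ) ≤ |t|)) _
    exact h.trans (mul_le_mul_of_nonneg_right (le_max_left _ _) hl)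
  set x₀ : ℝ := max x₁ (Real.exp 1) with hx₀
  set C : ℝ := C₁ + max (Real.log B) (Real.log A₁ + (2 / 3) * |Real.log A| + C₂ * A) with hCdef
  refine ⟨x₀, C, le_trans hx₁ (le_max_left _ _), fun x hx t ht2 htA => ?_⟩
  have hx1 : x₁ ≤ x := le_trans (le_max_left _ _) hx
  have hxe : Real.exp 1 ≤ x := le_trans (le_max_right _ _) hx
  have hx3 : 3 ≤ x := le_trans hx₁ hx1
  have hlogx : 1 ≤ Real.log x := by
    rw [← Real.log_exp 1]; exact Real.log_le_log (Real.exp_pos 1) hxe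
  have hlogx0 : 0 < Real.log x := by linarith
  have hσ1 : 1 < sigmaX x := one_lt_sigmaX (by linarith)
  have hσ2 : sigmaX x ≤ 2 := sigmaX_le_two hxe
  have hσsub : sigmaX x - 1 = 1 / Real.log x := by rw [sigmaX]; ring
  -- (D1c) at `u = t`
  have hD' := hD x hx1 t
  rw [twistedChar_one] at hD'
  have hDge : Real.log (Real.log x) - Real.log ‖riemannZeta ((sigmaX x : ℂ) - t * I)‖ - C₁ ≤
      Sieve.pretentiousDistSq 1 (fun n : ℕ => (n : ℂ) ^ ((t : ℂ) * I)) x := by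
    have := (abs_le.1 hD').1; linarith
  -- the value `ζ(σ_x − it) = ζ(σ_x + (−t) i)`
  have hs : (sigmaX x : ℂ) - t * I = (sigmaX x : ℂ) + ((-t : ℝ) : ℂ) * I := by push_cast; ring
  have hne : riemannZeta ((sigmaX x : ℂ) - t * I) ≠ 0 := by
    refine riemannZeta_ne_zero_of_one_lt_re ?_
    simp; exact hσ1
  have hnorm0 : 0 < ‖riemannZeta ((sigmaX x : ℂ) - t * I)‖ := norm_pos_iff.2 hne
  have habs : |(-t)| = |t| := abs_neg t
  -- bound `log |ζ(σ_x − it)|`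
  have hlogζ : Real.log ‖riemannZeta ((sigmaX x : ℂ) - t * I)‖ ≤
      (2 / 3) * Real.log (Real.log x) +
        max (Real.log B) (Real.log A₁ + (2 / 3) * |Real.log A| + C₂ * A) := by
    have hllx : 0 ≤ Real.log (Real.log x) := Real.log_nonneg hlogx
    rcases le_or_gt |t| T₁ with ht3 | ht3
    · -- small heights: compactness
      have hb := hB (sigmaX x) (-t) hσ1.le hσ2 (by rw [habs]; exact ht2) (by rw [habs]; exact ht3)
      rw [← hs] at hb
      calc Real.log ‖riemannZeta ((sigmaX x : ℂ) - t * I)‖ ≤ Real.log B :=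
            Real.log_le_log hnorm0 hb
        _ ≤ (2 / 3) * Real.log (Real.log x) + max (Real.log B) _ := by
            have := le_max_left (Real.log B) (Real.log A₁ + (2 / 3) * |Real.log A| + C₂ * A)
            nlinarith
    · -- large heights: Grönwall + `(VK₁)`
      have ht2' : 2 ≤ |(-t)| := by rw [habs]; exact ht2
      have hg := hG 1 (sigmaX x) (-t) ht2' le_rfl hσ1.le
      rw [← hs] at hg
      have hvk := hZ₁ (-t) (by rw [habs]; exact ht3.le)
      rw [habs] at hvk hg
      push_cast at hg hvk
      have ht_gt3 : 3 < |t| := lt_of_le_of_lt hT₁3 ht3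
      have hlogt : 0 < Real.log |t| := Real.log_pos (by linarith)
      have hlogtA : Real.log |t| ≤ A * Real.log x := by
        calc Real.log |t| ≤ Real.log (x ^ A) := Real.log_le_log (by linarith) htA
          _ = A * Real.log x := Real.log_rpow (by linarith) A
      -- the exponential factor
      have hexp : Real.exp (C₂ * Real.log |t| * (sigmaX x - 1)) ≤ Real.exp (C₂ * A) := by
        refine Real.exp_le_exp.2 ?_
        rw [hσsub]
        calc C₂ * Real.log |t| * (1 / Real.log x) = C₂ * (Real.log |t| / Real.log x) := by ring
          _ ≤ C₂ * A := by
              refine mul_le_mul_of_nonneg_left ?_ hC₂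
              rw [div_le_iff₀ hlogx0]; exact hlogtA
      -- combine
      have hmain : ‖riemannZeta ((sigmaX x : ℂ) - t * I)‖ ≤
          A₁ * Real.log |t| ^ (2 / 3 : ℝ) * Real.exp (C₂ * A) :=
        hg.trans (mul_le_mul hvk hexp (Real.exp_pos _).le (by positivity))
      have hpos : 0 < A₁ * Real.log |t| ^ (2 / 3 : ℝ) * Real.exp (C₂ * A) := by positivity
      have hlog_main : Real.log (A₁ * Real.log |t| ^ (2 / 3 : ℝ) * Real.exp (C₂ * A)) =
          Real.log A₁ + (2 / 3) * Real.log (Real.log |t|) + C₂ * A := by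
        rw [Real.log_mul (by positivity) (Real.exp_pos _).ne', Real.log_mul (by positivity) (by positivity),
          Real.log_rpow hlogt, Real.log_exp]
      have hllt : Real.log (Real.log |t|) ≤ Real.log (Real.log x) + |Real.log A| := by
        calc Real.log (Real.log |t|) ≤ Real.log (A * Real.log x) := Real.log_le_log hlogt hlogtA
          _ = Real.log A + Real.log (Real.log x) := Real.log_mul hA.ne' hlogx0.ne'
          _ ≤ Real.log (Real.log x) + |Real.log A| := by have := le_abs_self (Real.log A); linarith
      calc Real.log ‖riemannZeta ((sigmaX x : ℂ) - t * I)‖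
          ≤ Real.log (A₁ * Real.log |t| ^ (2 / 3 : ℝ) * Real.exp (C₂ * A)) := Real.log_le_log hnorm0 hmain
        _ = Real.log A₁ + (2 / 3) * Real.log (Real.log |t|) + C₂ * A := hlog_main
        _ ≤ (2 / 3) * Real.log (Real.log x) + (Real.log A₁ + (2 / 3) * |Real.log A| + C₂ * A) := by
            nlinarith
        _ ≤ (2 / 3) * Real.log (Real.log x) + max (Real.log B) _ := by
            have := le_max_right (Real.log B) (Real.log A₁ + (2 / 3) * |Real.log A| + C₂ * A)
            linarith
  rw [hCdef]
  linarith

/-- **Matomäki–Radziwiłł 2016, Lemma 2, from `(VK₁)`** (squared form, the `ε` of the printed statement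
taken `0`): if `|ζ(1 + it)| ≤ A₀ (log t)^{2/3}` for `t ≥ T₀`, then for every `A > 0` there are `x₀, C` such
that for every `f : ℕ → [-1, 1]`, `x ≥ x₀` and `1 ≤ |α| ≤ x^A`, `𝔻(f, n^{iα}; x)² ≥ (1/12) log log x − C`.
Proof: `4 𝔻(f, n^{iα})² ≥ 𝔻(1, n^{2iα})²` termwise (`pretentiousDistSq_one_double_le`) and the previous
theorem with `A + 1`. [cite: MatomakiRadziwillAnnals2016, Lemma 2] -/
theorem matomakiRadziwill_lemma2_of_oneLine {A₀ T₀ : ℝ}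
    (hZ : ∀ t : ℝ, T₀ ≤ t → ‖riemannZeta (1 + t * I)‖ ≤ A₀ * Real.log t ^ (2 / 3 : ℝ))
    {A : ℝ} (hA : 0 < A) :
    ∃ x₀ C : ℝ, 3 ≤ x₀ ∧ ∀ x : ℝ, x₀ ≤ x → ∀ α : ℝ, 1 ≤ |α| → |α| ≤ x ^ A →
      ∀ f : ℕ → ℝ, (∀ n, |f n| ≤ 1) →
        Real.log (Real.log x) / 12 - C ≤
          Sieve.pretentiousDistSq (fun n => (f n : ℂ)) (fun n : ℕ => (n : ℂ) ^ ((α : ℂ) * I)) x := by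
  obtain ⟨x₀, C, hx₀, h⟩ := pretentiousDistSq_one_twist_ge_of_oneLine hZ (A := A + 1) (by linarith)
  refine ⟨x₀, C / 4, hx₀, fun x hx α hα1 hαA f hf => ?_⟩
  have hx3 : 3 ≤ x := hx₀.trans hx
  have h2α : 2 ≤ |2 * α| := by rw [abs_mul, abs_two]; linarith
  have h2αA : |2 * α| ≤ x ^ (A + 1) := by
    rw [abs_mul, abs_two, Real.rpow_add (by linarith), Real.rpow_one]
    have : 0 ≤ x ^ A := by positivity
    nlinarith
  have h1 := h x hx (2 * α) h2α h2αA
  have h2 := pretentiousDistSq_one_double_le hf α x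
  linarith

end PretentiousFord

end Literature.NumberTheory.LFunctions

namespace Literature.NumberTheory.Sieve

open Finset Real Complex
open Literature.NumberTheory.LFunctions.GranvilleSoundararajan
open MatomakiRadziwillL3

/-! ### Lemma 3 from GS Theorem 1 and a distance lower bound -/

/-- **Matomäki–Radziwiłł 2016, Lemma 3, from Granville–Soundararajan's Theorem 1 and the distance bound of
Lemma 2 taken as a hypothesis**: if for every `A' > 0` there are `x₀ ≥ 0`, `C_D` with
`𝔻(1, n^{iτ}; x)² ≥ (1/3) log log x − C_D` for `x ≥ x₀`, `2 ≤ |τ| ≤ x^{A'}`, then Lemma 3 holds.  This is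
the assembly of `MatomakiRadziwill2016_lemma3_of_GS_ford` with its one use of `zeta_bound_ford`
(through `PretentiousFord.pretentiousDistSq_one_twist_ge`, at `A' = 4A + 8`) abstracted; the proof is
otherwise verbatim (MR §2: split `n = n₁n₂` by the `[P,Q]`-part, Halász in the form of MR Lemma 1 on the
fibres for `n₁ ≤ X^{3/4}`, Rankin's trick beyond). [cite: MatomakiRadziwillAnnals2016, Lemma 3] -/
theorem MatomakiRadziwill2016_lemma3_of_GS_dist
    (hGS : Literature.NumberTheory.LFunctions.GranvilleSoundararajan.GranvilleSoundararajan2003_theorem1)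
    (hDist : ∀ A' : ℝ, 0 < A' → ∃ x₀ C_D : ℝ, 0 ≤ x₀ ∧ ∀ x : ℝ, x₀ ≤ x → ∀ τ : ℝ, 2 ≤ |τ| → |τ| ≤ x ^ A' →
      Real.log (Real.log x) / 3 - C_D ≤ pretentiousDistSq 1 (fun n : ℕ => (n : ℂ) ^ ((τ : ℂ) * I)) x) :
    MatomakiRadziwill2016_lemma3 := by
  intro A hA
  obtain ⟨C_H, hC_H, hH⟩ := halasz_of_GS hGS
  obtain ⟨x₀, C_D, hx₀, hD⟩ := hDist (4 * A + 8) (by linarith)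
  obtain ⟨C_M, hCM⟩ := RankinComposed.exists_abs_sum_inv_primes_Icc_sub_le
  set K₁ : ℝ := 30 * C_H * Real.exp (RankinComposed.C₀ + 2 * C_M + (39 / 80) * (Real.log 5 + C_M) + (39 / 160) * |C_D|) +
    114 * C_H * Real.exp (RankinComposed.C₀ + C_M) with hK₁
  set K₂ : ℝ := 2 + 6 * Real.exp (C_M + 3 + RankinComposed.C₀ + 24 * Real.exp 288) +
    (400 / 3) * Real.exp (Real.exp 400 + RankinComposed.C₀) + 450 * Real.exp RankinComposed.C₀ with hK₂
  set X₀ : ℝ := max (Real.exp ((4 : ℝ) ^ 16)) (max ((2 * x₀) ^ 4) (3 * (2 : ℝ) ^ (4 * A + 8))) with hX₀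
  have hK₁0 : 0 ≤ K₁ := by positivity
  have hK₂0 : 0 ≤ K₂ := by positivity
  have hX₀1 : Real.exp ((4:ℝ) ^ 16) ≤ X₀ := le_max_left _ _
  have hlogX₀ : (1 : ℝ) ≤ Real.log X₀ := by
    have := Real.log_le_log (Real.exp_pos _) hX₀1
    rw [Real.log_exp] at this
    have : (1:ℝ) ≤ 4 ^ 16 := by norm_num
    linarith
  refine ⟨2 * Real.log X₀ ^ (1 / 16 : ℝ) + K₁ + K₂, ?_⟩
  intro f hf hf1 X P Q t hP hPQ hQX ht htA
  show ‖∑ n ∈ Finset.Icc ⌈X⌉₊ ⌊2 * X⌋₊, summandR f P Q t n‖ ≤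
    (2 * Real.log X₀ ^ (1 / 16 : ℝ) + K₁ + K₂) * (T1 X P Q + T2 X Q)
  have hX2 : 2 ≤ X := (hP.trans hPQ).trans hQX
  have hlogX : 0 < Real.log X := Real.log_pos (by linarith)
  have hT1 := inv_rpow_le_T1 hP hPQ hlogX
  have hT1pos : 0 < T1 X P Q := lt_of_lt_of_le (by positivity) hT1
  have hT2 : 0 ≤ T2 X Q := by unfold T2; positivity
  by_cases hlarge : X₀ ≤ X
  · obtain ⟨hℓ, hYx₀, hXA⟩ := threshold hx₀ (hX₀ ▸ hlarge)
    have hℓ1 : 1 ≤ Real.log X := le_trans (by norm_num) hℓ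
    rw [sum_split f P Q t X ⌊X ^ (3 / 4 : ℝ)⌋₊]
    refine (norm_add_le _ _).trans ?_
    have h1 := first_part_numeric hC_H hH hD hCM hf hf1 hP hPQ hQX hℓ hYx₀ hXA ht htA hA.le
    have h2 := second_part_numeric hCM hf1 hP hPQ hQX hℓ1 (t := t)
    rw [← hK₁] at h1; rw [← hK₂] at h2
    have hL0 : 0 ≤ 2 * Real.log X₀ ^ (1 / 16 : ℝ) := by positivity
    have h5 : K₁ * T1 X P Q + K₂ * (T1 X P Q + T2 X Q) ≤
        (2 * Real.log X₀ ^ (1 / 16 : ℝ) + K₁ + K₂) * (T1 X P Q + T2 X Q) := by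
      nlinarith [mul_nonneg hL0 hT1pos.le, mul_nonneg hL0 hT2, mul_nonneg hK₁0 hT2]
    linarith
  · -- small `X`: the trivial bound
    push Not at hlarge
    have hR : ‖∑ n ∈ Finset.Icc ⌈X⌉₊ ⌊2 * X⌋₊, summandR f P Q t n‖ ≤ 2 := by
      have := norm_sum_filter_summandR_le_two hf1 P Q t (by linarith : (1:ℝ) ≤ X) (fun _ => True)
      simpa using this
    have hmono : Real.log X ^ (1 / 16 : ℝ) ≤ Real.log X₀ ^ (1 / 16 : ℝ) :=
      Real.rpow_le_rpow hlogX.le (Real.log_le_log (by linarith) hlarge.le) (by norm_num)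
    have h3 : (2 : ℝ) ≤ 2 * Real.log X₀ ^ (1 / 16 : ℝ) * T1 X P Q := by
      have hpos : 0 < Real.log X ^ (1 / 16 : ℝ) := by positivity
      have : 1 ≤ Real.log X₀ ^ (1 / 16 : ℝ) * (1 / Real.log X ^ (1 / 16 : ℝ)) := by
        rw [mul_one_div, le_div_iff₀ hpos, one_mul]; exact hmono
      nlinarith [mul_le_mul_of_nonneg_left hT1 (show 0 ≤ Real.log X₀ ^ (1 / 16 : ℝ) by positivity)]
    have h4 : 2 * Real.log X₀ ^ (1 / 16 : ℝ) * T1 X P Q ≤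
        (2 * Real.log X₀ ^ (1 / 16 : ℝ) + K₁ + K₂) * (T1 X P Q + T2 X Q) := by
      have hL0 : 0 ≤ 2 * Real.log X₀ ^ (1 / 16 : ℝ) := by positivity
      nlinarith [mul_nonneg hK₁0 hT1pos.le, mul_nonneg hK₂0 hT1pos.le, mul_nonneg hL0 hT2,
        mul_nonneg hK₁0 hT2, mul_nonneg hK₂0 hT2]
    linarith

/-! ### The chain down to Theorem 3, Theorem 1 and parity.S38 -/

/-- **Lemma 3 from `(VK₁)` alone**: Granville–Soundararajan's Theorem 1 is discharged in the tree
(`GranvilleSoundararajan2003_theorem1_holds`) and the distance bound comes from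
`PretentiousFord.pretentiousDistSq_one_twist_ge_of_oneLine`. [cite: MatomakiRadziwillAnnals2016, Lemma 3] -/
theorem MatomakiRadziwill2016_lemma3_of_oneLine {A₀ T₀ : ℝ}
    (hZ : ∀ t : ℝ, T₀ ≤ t → ‖riemannZeta (1 + t * I)‖ ≤ A₀ * Real.log t ^ (2 / 3 : ℝ)) :
    MatomakiRadziwill2016_lemma3 :=
  MatomakiRadziwill2016_lemma3_of_GS_dist GranvilleSoundararajan2003_theorem1_holds fun A' hA' => by
    obtain ⟨x₀, C_D, hx₀, h⟩ :=
      Literature.NumberTheory.LFunctions.PretentiousFord.pretentiousDistSq_one_twist_ge_of_oneLine hZ hA'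
    exact ⟨x₀, C_D, by linarith, h⟩

/-- **Proposition 1 from `(VK₁)` and Lemma 11.** [cite: MatomakiRadziwillAnnals2016, Proposition 1] -/
theorem MatomakiRadziwill2016_prop1_of_oneLine_lemma11 {A₀ T₀ : ℝ}
    (hZ : ∀ t : ℝ, T₀ ≤ t → ‖riemannZeta (1 + t * I)‖ ≤ A₀ * Real.log t ^ (2 / 3 : ℝ))
    (h11 : MatomakiRadziwill2016_lemma11) : MatomakiRadziwill2016_prop1 :=
  MatomakiRadziwill2016_prop1_of_lemma3_lemma11 (MatomakiRadziwill2016_lemma3_of_oneLine hZ) h11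

/-- **Theorem 3 from `(VK₁)`, Lemma 4 and Lemma 11** — the three inputs of
`MatomakiRadziwill2016_theorem3` not yet discharged in the tree, with the analytic one in its minimal
form. [cite: MatomakiRadziwillAnnals2016, Theorem 3] -/
theorem MatomakiRadziwill2016_theorem3_of_oneLine_lemma4_lemma11 {A₀ T₀ : ℝ}
    (hZ : ∀ t : ℝ, T₀ ≤ t → ‖riemannZeta (1 + t * I)‖ ≤ A₀ * Real.log t ^ (2 / 3 : ℝ))
    (h4 : MatomakiRadziwill2016_lemma4) (h11 : MatomakiRadziwill2016_lemma11) :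
    MatomakiRadziwill2016_theorem3 :=
  MatomakiRadziwill2016_theorem3_of_lemma3_lemma4_lemma11 (MatomakiRadziwill2016_lemma3_of_oneLine hZ) h4 h11

/-- **Theorem 1 from `(VK₁)`, Lemma 4 and Lemma 11.** [cite: MatomakiRadziwillAnnals2016, Theorem 1] -/
theorem MatomakiRadziwill2016_theorem1_of_oneLine_lemma4_lemma11 {A₀ T₀ : ℝ}
    (hZ : ∀ t : ℝ, T₀ ≤ t → ‖riemannZeta (1 + t * I)‖ ≤ A₀ * Real.log t ^ (2 / 3 : ℝ))
    (h4 : MatomakiRadziwill2016_lemma4) (h11 : MatomakiRadziwill2016_lemma11) :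
    MatomakiRadziwill2016_theorem1 :=
  MatomakiRadziwill2016_theorem1_of_theorem3 (MatomakiRadziwill2016_theorem3_of_oneLine_lemma4_lemma11 hZ h4 h11)

/-- **parity.S38 (`matomaki_radziwill`) from `(VK₁)`, Lemma 4 and Lemma 11.**
[cite: MatomakiRadziwillAnnals2016, Theorem 1] -/
theorem matomaki_radziwill_of_oneLine_lemma4_lemma11 {A₀ T₀ : ℝ}
    (hZ : ∀ t : ℝ, T₀ ≤ t → ‖riemannZeta (1 + t * I)‖ ≤ A₀ * Real.log t ^ (2 / 3 : ℝ))
    (h4 : MatomakiRadziwill2016_lemma4) (h11 : MatomakiRadziwill2016_lemma11) : matomaki_radziwill :=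
  matomaki_radziwill_of_theorem1 (MatomakiRadziwill2016_theorem1_of_oneLine_lemma4_lemma11 hZ h4 h11)

/-- The Ford instance: **Theorem 3 from `zeta_bound_ford`, Lemma 4 and Lemma 11** through `(VK₁)` with
`A₀ = 76.2`, `T₀ = 3` (agrees with the route through `MatomakiRadziwill2016_prop1_of_ford_lemma11`).
[cite: MatomakiRadziwillAnnals2016, Theorem 3] [cite: Ford2002, Theorem 1] -/
theorem MatomakiRadziwill2016_theorem3_of_ford_lemma4_lemma11
    (hF : Literature.NumberTheory.LFunctions.zeta_bound_ford)
    (h4 : MatomakiRadziwill2016_lemma4) (h11 : MatomakiRadziwill2016_lemma11) :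
    MatomakiRadziwill2016_theorem3 :=
  MatomakiRadziwill2016_theorem3_of_oneLine_lemma4_lemma11
    (Literature.NumberTheory.LFunctions.PretentiousFord.oneLine_of_ford hF) h4 h11

end Literature.NumberTheory.Sieve
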